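import Mathlib
import HarnessLib
import Summits.Ventures.LatticeQCDFlow.Exactness.CompactHaar
import Summits.Ventures.LatticeQCDFlow.Scaling.AutoregressiveGaugePlaquetteMarginal
import Summits.Ventures.LatticeQCDFlow.Scaling.AutoregressiveGaugeAcceptanceCeiling

/-!
# LatticeQCDFlow / Scaling — the one-staple total-variation floor for EVERY link of a plaquette: whichever
# of its four links is generated last, the exact conditional of that link given the other three (all else
# integrated) is at Wilson-average `L¹` distance `≥ (1/N)∫Re tr ρ(U_p) e^{−βS_W}` from the flat law

HONEST FRAMING: exact (Metropolis-corrected) sampling algorithms for lattice gauge theory;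
figures of merit are autocorrelation/cost numbers at stated couplings and volumes; no
continuum-physics claim.

Venture `LatticeQCDFlow` (cell pub-lqcd), topic `Scaling`, FANOUT row 30 (lean-1, GEN-20) — OUR WORK on
THEORY-2.md §4 row C5.  Gen-18's `Scaling/AutoregressiveGaugePlaquetteMarginal.wilson_plaquetteMarginal_tv_lower_bound`
is stated for the FIRST link `(x, k)` of the plaquette `(x; k, l)`; in a generation order the last link of
a plaquette may be any of the four.  Here the same floor for each of them (the closing link enters the
holonomy as `v·B`, `A·v·B`, `A·v⁻¹·B` or `A·v⁻¹`; left/right/inversion invariance of the Haar probability,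
`Exactness/CompactHaar`), and the resulting conditional-error floor at a link generated after the other
three links of one of its plaquettes from a conditional blind at one of its endpoints — the form consumed
by `Scaling/AutoregressiveGaugeKLExtensive`.

## What is proved (all [ours])

* §1 `plaquetteHolonomy_update_second/third/fourth` — updating one link moves the holonomy by a
  left/right translate (or an inverse); `integral_comp_plaquetteHolonomy_mul_of_mem` — for EACH link
  `e` of the plaquette and every bounded measurable `H`, `Φ` with `Φ` blind to `e`:
  `∫ H(U_p)·Φ dπ = (∫ H dHaar)·∫ Φ dπ`.
* §2 **`wilson_plaquetteMarginal_tv_lower_bound_of_mem`** — for each link `e` of `p = (x; k, l)` and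
  `s_H` = the links off `p`: `∫ Re tr ρ(U_p)·e^{−βS_W} dπ ≤ N·∫|A_{s_H}F − A_{insert e s_H}F| dπ`
  (continuous `ρ` with a central element acting by `ω ≠ 1`, `L ≥ 2`, any `β`).
* §3 **`wilson_condGap_ge_plaquette_of_mem`** — for each link `e` of `p`, every `s ⊆ s_H`, every bounded
  measurable `q ≥ 0` normalised in `e` and blind to every other link at an endpoint `y` of `e`:
  `(1/N)∫Re tr ρ(U_p)·F dπ ≤ ∫|A_sF − q·A_{insert e s}F| dπ`.

NOT CLAIMED: anything beyond the one-plaquette floor.  No `def`, no `sorry`, nothing cited as a fact.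
-/

noncomputable section

namespace Summit.Ventures.LatticeQCDFlow.Theory2.Autoregressive

open MeasureTheory Function Set
open Literature.MathematicalPhysics.QuantumFieldTheory Literature.MathematicalPhysics.QuantumLattice
open Summit.Ventures.LatticeQCDFlow.Exactness

variable {d L N : ℕ} {G : Type*} [Group G] [TopologicalSpace G] [IsTopologicalGroup G]
  [CompactSpace G] [SecondCountableTopology G] [MeasurableSpace G] [BorelSpace G] [NeZero L]
  (ρ : G →* Matrix (Fin N) (Fin N) ℂ)

/-! ## §1 Redrawing any one link of a plaquette makes its holonomy Haar -/

omit [TopologicalSpace G] [IsTopologicalGroup G] [CompactSpace G] [SecondCountableTopology G]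
  [MeasurableSpace G] [BorelSpace G] [NeZero L] in
/-- Updating the SECOND link `(x+e_i, j)`: `U_p ↦ U(x,i)·v·(U(x+e_j,i)⁻¹U(x,j)⁻¹)`. [ours] -/
theorem plaquetteHolonomy_update_second [NeZero L] (hL : 2 ≤ L) (U : GaugeConfig d L G) (x : Site d L)
    {i j : Fin d} (hij : i ≠ j) (v : G) :
    plaquetteHolonomy (update U (x.shift i, j) v) x i j =
      U (x, i) * v * ((U (x.shift j, i))⁻¹ * (U (x, j))⁻¹) := by
  have n1 : ((x, i) : Edge d L) ≠ (x.shift i, j) := fun h => hij (congrArg Prod.snd h)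
  have n3 : ((x.shift j, i) : Edge d L) ≠ (x.shift i, j) := fun h => hij (congrArg Prod.snd h)
  have n4 : ((x, j) : Edge d L) ≠ (x.shift i, j) := fun h => (site_shift_ne hL x i) (congrArg Prod.fst h).symm
  simp only [plaquetteHolonomy, update_self, update_of_ne n1, update_of_ne n3, update_of_ne n4, mul_assoc]

omit [TopologicalSpace G] [IsTopologicalGroup G] [CompactSpace G] [SecondCountableTopology G]
  [MeasurableSpace G] [BorelSpace G] [NeZero L] in
/-- Updating the THIRD link `(x+e_j, i)`: `U_p ↦ (U(x,i)U(x+e_i,j))·v⁻¹·U(x,j)⁻¹`. [ours] -/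
theorem plaquetteHolonomy_update_third [NeZero L] (hL : 2 ≤ L) (U : GaugeConfig d L G) (x : Site d L)
    {i j : Fin d} (hij : i ≠ j) (v : G) :
    plaquetteHolonomy (update U (x.shift j, i) v) x i j =
      U (x, i) * U (x.shift i, j) * v⁻¹ * (U (x, j))⁻¹ := by
  have n1 : ((x, i) : Edge d L) ≠ (x.shift j, i) := fun h => (site_shift_ne hL x j) (congrArg Prod.fst h).symm
  have n2 : ((x.shift i, j) : Edge d L) ≠ (x.shift j, i) := fun h => hij (congrArg Prod.snd h).symm
  have n4 : ((x, j) : Edge d L) ≠ (x.shift j, i) := fun h => hij (congrArg Prod.snd h).symm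
  simp only [plaquetteHolonomy, update_self, update_of_ne n1, update_of_ne n2, update_of_ne n4]

omit [TopologicalSpace G] [IsTopologicalGroup G] [CompactSpace G] [SecondCountableTopology G]
  [MeasurableSpace G] [BorelSpace G] [NeZero L] in
/-- Updating the FOURTH link `(x, j)`: `U_p ↦ (U(x,i)U(x+e_i,j)U(x+e_j,i)⁻¹)·v⁻¹`. [ours] -/
theorem plaquetteHolonomy_update_fourth [NeZero L] (hL : 2 ≤ L) (U : GaugeConfig d L G) (x : Site d L)
    {i j : Fin d} (hij : i ≠ j) (v : G) :
    plaquetteHolonomy (update U (x, j) v) x i j =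
      U (x, i) * U (x.shift i, j) * (U (x.shift j, i))⁻¹ * v⁻¹ := by
  have n1 : ((x, i) : Edge d L) ≠ (x, j) := fun h => hij (congrArg Prod.snd h)
  have n2 : ((x.shift i, j) : Edge d L) ≠ (x, j) := fun h => (site_shift_ne hL x i) (congrArg Prod.fst h)
  have n3 : ((x.shift j, i) : Edge d L) ≠ (x, j) := fun h => hij (congrArg Prod.snd h)
  simp only [plaquetteHolonomy, update_self, update_of_ne n1, update_of_ne n2, update_of_ne n3]

/-- **Redrawing ANY one link of a plaquette makes its holonomy Haar, independently of everything blind to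
that link**: for each `e ∈ {(x,i), (x+e_i,j), (x+e_j,i), (x,j)}`, bounded measurable `H : G → ℝ` and
bounded measurable `Φ` blind to `e`, `∫ H(U_p)·Φ dπ = (∫ H dHaar)·∫ Φ dπ`. [ours] -/
theorem integral_comp_plaquetteHolonomy_mul_of_mem (hL : 2 ≤ L) (x : Site d L) {i j : Fin d} (hij : i ≠ j)
    {e : Edge d L} (he : e ∈ ({(x, i), (x.shift i, j), (x.shift j, i), (x, j)} : Finset (Edge d L)))
    {H : G → ℝ} (hHm : Measurable H) {C : ℝ} (hHb : ∀ g, |H g| ≤ C)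
    {Φ : GaugeConfig d L G → ℝ} (hΦm : Measurable Φ) {C' : ℝ} (hΦb : ∀ U, |Φ U| ≤ C')
    (hΦe : ∀ U v, Φ (update U e v) = Φ U) :
    ∫ U, H (plaquetteHolonomy U x i j) * Φ U ∂Measure.pi (fun _ : Edge d L => haarProbability G) =
      (∫ g, H g ∂(haarProbability G)) * ∫ U, Φ U ∂Measure.pi (fun _ : Edge d L => haarProbability G) := by
  set μ := haarProbability G with hμ
  have huniv : (fun _ : Edge d L => μ) e Set.univ ≠ 0 := by simp [hμ]
  have hFm : Measurable fun U : GaugeConfig d L G => H (plaquetteHolonomy U x i j) * Φ U :=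
    (hHm.comp (measurable_plaquetteHolonomy x i j)).mul hΦm
  have hC : 0 ≤ C := (abs_nonneg _).trans (hHb 1)
  have hFi : Integrable (fun U : GaugeConfig d L G => H (plaquetteHolonomy U x i j) * Φ U)
      (Measure.pi fun _ : Edge d L => μ) :=
    Integrable.mono' (integrable_const (C * C')) hFm.aestronglyMeasurable
      (ae_of_all _ fun U => by
        rw [Real.norm_eq_abs, abs_mul]
        exact mul_le_mul (hHb _) (hΦb _) (abs_nonneg _) hC)
  rw [integral_pi_eq_integral_integral_update' (fun _ : Edge d L => μ) e huniv hFi]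
  simp only [measure_univ, inv_one, ENNReal.toReal_one, one_smul]
  -- the inner integral over the redrawn link is `(∫ H dHaar)·Φ U` in each of the four cases
  have hinner : ∀ U : GaugeConfig d L G,
      ∫ v, H (plaquetteHolonomy (update U e v) x i j) * Φ (update U e v) ∂μ = (∫ g, H g ∂μ) * Φ U := by
    intro U
    simp only [hΦe]
    rw [integral_mul_const]
    congr 1
    simp only [Finset.mem_insert, Finset.mem_singleton] at he
    rcases he with rfl | rfl | rfl | rfl
    · simp only [plaquetteHolonomy_update_first hL U x hij]
      exact integral_mul_right_eq_self H _
    · simp only [plaquetteHolonomy_update_second hL U x hij, mul_assoc]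
      rw [integral_mul_right_eq_self (fun g => H (U (x, i) * g)) ((U (x.shift j, i))⁻¹ * (U (x, j))⁻¹)]
      exact integral_mul_left_eq_self H _
    · simp only [plaquetteHolonomy_update_third hL U x hij]
      rw [integral_inv_eq_self (fun g => H (U (x, i) * U (x.shift i, j) * g * (U (x, j))⁻¹)) μ]
      simp only [mul_assoc]
      rw [integral_mul_right_eq_self (fun g => H (U (x, i) * (U (x.shift i, j) * g))) ((U (x, j))⁻¹),
        integral_mul_left_eq_self (fun g => H (U (x, i) * g)) (U (x.shift i, j))]
      exact integral_mul_left_eq_self H _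
    · simp only [plaquetteHolonomy_update_fourth hL U x hij]
      rw [integral_inv_eq_self (fun g => H (U (x, i) * U (x.shift i, j) * (U (x.shift j, i))⁻¹ * g)) μ]
      exact integral_mul_left_eq_self H _
  simp_rw [hinner]
  rw [integral_const_mul]

/-! ## §2 The one-staple total-variation floor for every link of the plaquette -/

/-- **THE FLOOR FOR EVERY LINK OF THE PLAQUETTE.**  Continuous `ρ` with a central element acting by a
scalar `ω ≠ 1`, `L ≥ 2`, any `β`; `p = (x; k, l)`; `e` any of its four links; `s_H` the links off `p`.  Then
`∫ Re tr ρ(U_p)·e^{−βS_W} dπ ≤ N·∫|A_{s_H}F − A_{insert e s_H}F| dπ`. [ours] -/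
theorem wilson_plaquetteMarginal_tv_lower_bound_of_mem (hρ : Continuous ρ) (hL : 2 ≤ L)
    {z : G} {ω : ℂ} (hω : ρ z = ω • (1 : Matrix (Fin N) (Fin N) ℂ)) (hne : ω ≠ 1)
    (β : ℝ) (p : Plaquette d L) {e : Edge d L}
    (he : e ∈ ({(p.1, p.2.1.1), (p.1.shift p.2.1.1, p.2.1.2), (p.1.shift p.2.1.2, p.2.1.1), (p.1, p.2.1.2)} :
      Finset (Edge d L))) :
    ∫ U, (ρ (plaquetteHolonomy U p.1 p.2.1.1 p.2.1.2)).trace.re * Real.exp (-β * wilsonAction ρ U)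
        ∂Measure.pi (fun _ : Edge d L => haarProbability G) ≤
      (N : ℝ) * ∫ U, |coordAvg (haarProbability G)
            (Finset.univ \ {(p.1, p.2.1.1), (p.1.shift p.2.1.1, p.2.1.2), (p.1.shift p.2.1.2, p.2.1.1), (p.1, p.2.1.2)})
            (fun V : GaugeConfig d L G => Real.exp (-β * wilsonAction ρ V)) U -
          coordAvg (haarProbability G)
            (insert e
              (Finset.univ \ {(p.1, p.2.1.1), (p.1.shift p.2.1.1, p.2.1.2), (p.1.shift p.2.1.2, p.2.1.1), (p.1, p.2.1.2)}))
            (fun V : GaugeConfig d L G => Real.exp (-β * wilsonAction ρ V)) U|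
        ∂Measure.pi (fun _ : Edge d L => haarProbability G) := by
  classical
  haveI : Fact (1 < L) := ⟨hL⟩
  set μ := haarProbability G with hμ
  set x := p.1 with hx
  set k := p.2.1.1 with hk
  set l := p.2.1.2 with hl
  have hkl : k ≠ l := ne_of_lt p.2.2
  set pl : Finset (Edge d L) := {(x, k), (x.shift k, l), (x.shift l, k), (x, l)} with hpl
  set s : Finset (Edge d L) := Finset.univ \ pl with hs
  set F : GaugeConfig d L G → ℝ := fun V => Real.exp (-β * wilsonAction ρ V) with hF
  set Nf := coordAvg μ s F with hN'
  set M := coordAvg μ (insert e s) F with hM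
  obtain ⟨hFm, B, hFlo, hFhi⟩ := wilsonWeight_props (d := d) (L := L) ρ hρ β
  have hFb : ∀ U, |F U| ≤ Real.exp (|β| * B) := fun U => by
    simp only [hF]; rw [abs_of_pos (Real.exp_pos _)]; exact hFhi U
  have hNb : ∀ U, Real.exp (-(|β| * B)) ≤ Nf U ∧ Nf U ≤ Real.exp (|β| * B) := fun U =>
    coordAvg_mem_Icc μ s hFm hFlo hFhi U
  have hMb : ∀ U, Real.exp (-(|β| * B)) ≤ M U ∧ M U ≤ Real.exp (|β| * B) := fun U =>
    coordAvg_mem_Icc μ (insert e s) hFm hFlo hFhi U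
  have hNabs : ∀ U, |Nf U| ≤ Real.exp (|β| * B) := fun U => by
    rw [abs_of_pos (lt_of_lt_of_le (Real.exp_pos _) (hNb U).1)]; exact (hNb U).2
  have hMabs : ∀ U, |M U| ≤ Real.exp (|β| * B) := fun U => by
    rw [abs_of_pos (lt_of_lt_of_le (Real.exp_pos _) (hMb U).1)]; exact (hMb U).2
  have hNm : Measurable Nf := measurable_coordAvg _ s hFm
  have hMm : Measurable M := measurable_coordAvg _ (insert e s) hFm
  have hMe : ∀ (U : GaugeConfig d L G) (v : G), M (update U e v) = M U := by
    intro U v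
    refine coordAvg_congr_off (insert e s) F fun e' he' => ?_
    have : e' ≠ e := fun h => he' (h ▸ Finset.mem_insert_self e s)
    exact update_of_ne this _ _
  -- the observable
  have hrm : Measurable fun g : G => (ρ g).trace.re := (Complex.continuous_re.comp hρ.matrix_trace).measurable
  have hXb : ∀ g : G, |(ρ g).trace.re| ≤ (N : ℝ) := fun g => by
    simpa using Literature.RepresentationTheory.CompactGroups.CompactGroup.abs_re_trace_le_card ρ hρ g
  have hXm : Measurable fun U : GaugeConfig d L G => (ρ (plaquetteHolonomy U x k l)).trace.re :=
    hrm.comp (measurable_plaquetteHolonomy x k l)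
  have hn1 : ((x, k) : Edge d L) ∉ s := by simp [hs, hpl]
  have hn2 : ((x.shift k, l) : Edge d L) ∉ s := by simp [hs, hpl]
  have hn3 : ((x.shift l, k) : Edge d L) ∉ s := by simp [hs, hpl]
  have hn4 : ((x, l) : Edge d L) ∉ s := by simp [hs, hpl]
  have hhol_s : ∀ U V : GaugeConfig d L G,
      plaquetteHolonomy (s.piecewise V U) x k l = plaquetteHolonomy U x k l := by
    intro U V
    simp only [plaquetteHolonomy, Finset.piecewise_eq_of_notMem _ _ _ hn1,
      Finset.piecewise_eq_of_notMem _ _ _ hn2, Finset.piecewise_eq_of_notMem _ _ _ hn3,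
      Finset.piecewise_eq_of_notMem _ _ _ hn4]
  -- Step 1: `∫ X F = ∫ X N`
  have h1 : ∫ U, (ρ (plaquetteHolonomy U x k l)).trace.re * F U ∂Measure.pi (fun _ : Edge d L => μ) =
      ∫ U, (ρ (plaquetteHolonomy U x k l)).trace.re * Nf U ∂Measure.pi (fun _ : Edge d L => μ) :=
    integral_mul_coordAvg_eq μ s (Φ := fun U => (ρ (plaquetteHolonomy U x k l)).trace.re) hFm ⟨_, hFb⟩
      hXm ⟨N, fun U => hXb _⟩ (fun U V => by simp only [hhol_s])
  -- Step 2: `∫ X M = (∫ Re tr ρ dHaar)·∫ M = 0`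
  have h0 : ∫ g, (ρ g).trace.re ∂(haarProbability G) = 0 := by
    rw [← integral_comp_plaquetteHolonomy hL x hkl hrm hXb]
    exact integral_re_trace_plaquetteHolonomy_eq_zero ρ hρ hω hne x hkl
  have h2 : ∫ U, (ρ (plaquetteHolonomy U x k l)).trace.re * M U ∂Measure.pi (fun _ : Edge d L => μ) = 0 := by
    rw [hμ, integral_comp_plaquetteHolonomy_mul_of_mem hL x hkl he hrm hXb hMm hMabs hMe, h0, zero_mul]
  -- Step 3: `∫ X N = ∫ X (N − M) ≤ N_dim ∫ |N − M|`
  have hiXN : Integrable (fun U : GaugeConfig d L G => (ρ (plaquetteHolonomy U x k l)).trace.re * Nf U)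
      (Measure.pi fun _ : Edge d L => μ) :=
    Integrable.mono' (integrable_const ((N : ℝ) * Real.exp (|β| * B))) ((hXm.mul hNm).aestronglyMeasurable)
      (ae_of_all _ fun U => by
        rw [Real.norm_eq_abs, abs_mul]
        exact mul_le_mul (hXb _) (hNabs U) (abs_nonneg _) (Nat.cast_nonneg N))
  have hiXM : Integrable (fun U : GaugeConfig d L G => (ρ (plaquetteHolonomy U x k l)).trace.re * M U)
      (Measure.pi fun _ : Edge d L => μ) :=
    Integrable.mono' (integrable_const ((N : ℝ) * Real.exp (|β| * B))) ((hXm.mul hMm).aestronglyMeasurable)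
      (ae_of_all _ fun U => by
        rw [Real.norm_eq_abs, abs_mul]
        exact mul_le_mul (hXb _) (hMabs U) (abs_nonneg _) (Nat.cast_nonneg N))
  have hiabs : Integrable (fun U : GaugeConfig d L G => |Nf U - M U|) (Measure.pi fun _ : Edge d L => μ) :=
    (Integrable.mono' (integrable_const _) hNm.aestronglyMeasurable
        (ae_of_all _ fun U => by rw [Real.norm_eq_abs]; exact hNabs U)).sub
      (Integrable.mono' (integrable_const _) hMm.aestronglyMeasurable
        (ae_of_all _ fun U => by rw [Real.norm_eq_abs]; exact hMabs U)) |>.abs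
  have h3 : ∫ U, (ρ (plaquetteHolonomy U x k l)).trace.re * Nf U ∂Measure.pi (fun _ : Edge d L => μ) =
      ∫ U, (ρ (plaquetteHolonomy U x k l)).trace.re * (Nf U - M U) ∂Measure.pi (fun _ : Edge d L => μ) := by
    have : ∀ U : GaugeConfig d L G, (ρ (plaquetteHolonomy U x k l)).trace.re * (Nf U - M U) =
        (ρ (plaquetteHolonomy U x k l)).trace.re * Nf U - (ρ (plaquetteHolonomy U x k l)).trace.re * M U :=
      fun U => by ring
    simp_rw [this]
    rw [integral_sub hiXN hiXM, h2, sub_zero]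
  rw [h1, h3, ← integral_const_mul]
  have hiL : Integrable (fun U : GaugeConfig d L G =>
      (ρ (plaquetteHolonomy U x k l)).trace.re * (Nf U - M U)) (Measure.pi fun _ : Edge d L => μ) :=
    (hiXN.sub hiXM).congr (ae_of_all _ fun U => by simp only [Pi.sub_apply]; ring)
  exact integral_mono hiL (hiabs.const_mul _) fun U =>
    (le_abs_self _).trans (by rw [abs_mul]; exact mul_le_mul_of_nonneg_right (hXb _) (abs_nonneg _))

/-! ## §3 The conditional-error floor at any link of the plaquette -/

/-- **The conditional `L¹` error at a link generated after the other three links of one of its plaquettes,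
from a conditional blind at one of its endpoints, is at least the plaquette mean.**  `e` any link of
`p = (x; k, l)`; `s` a set of links off `p`; `q ≥ 0` bounded measurable, normalised in `e`, blind to every
other link at an endpoint `y` of `e`.  Then `(1/N)∫Re tr ρ(U_p)·F dπ ≤ ∫|A_sF − q·A_{insert e s}F| dπ`
(`F = e^{−βS_W}`; continuous `ρ` with a central scalar `ω ≠ 1`, `L ≥ 2`, any `β`). [ours] -/
theorem wilson_condGap_ge_plaquette_of_mem (hρ : Continuous ρ) (hL : 2 ≤ L)
    {z : G} {ω : ℂ} (hω : ρ z = ω • (1 : Matrix (Fin N) (Fin N) ℂ)) (hne : ω ≠ 1) (β : ℝ)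
    (p : Plaquette d L) {e : Edge d L}
    (he : e ∈ ({(p.1, p.2.1.1), (p.1.shift p.2.1.1, p.2.1.2), (p.1.shift p.2.1.2, p.2.1.1), (p.1, p.2.1.2)} :
      Finset (Edge d L)))
    {s : Finset (Edge d L)}
    (hs : s ⊆ Finset.univ \
      {(p.1, p.2.1.1), (p.1.shift p.2.1.1, p.2.1.2), (p.1.shift p.2.1.2, p.2.1.1), (p.1, p.2.1.2)})
    {q : GaugeConfig d L G → ℝ} (hqm : Measurable q) (hq0 : ∀ U, 0 ≤ q U) {Cq : ℝ} (hqb : ∀ U, q U ≤ Cq)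
    (hq1 : ∀ U, ∫ v, q (update U e v) ∂(haarProbability G) = 1)
    {y : Site d L} (hy : e.1 = y ∨ e.1.shift e.2 = y)
    (hqB : ∀ e' : Edge d L, e'.1 = y ∨ e'.1.shift e'.2 = y → e' ≠ e →
      ∀ (U : GaugeConfig d L G) (v : G), q (update U e' v) = q U) :
    (N : ℝ)⁻¹ * ∫ U, (ρ (plaquetteHolonomy U p.1 p.2.1.1 p.2.1.2)).trace.re * Real.exp (-β * wilsonAction ρ U)
        ∂Measure.pi (fun _ : Edge d L => haarProbability G) ≤
      ∫ U, |coordAvg (haarProbability G) s (fun V : GaugeConfig d L G => Real.exp (-β * wilsonAction ρ V)) U -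
          q U * coordAvg (haarProbability G) (insert e s)
            (fun V : GaugeConfig d L G => Real.exp (-β * wilsonAction ρ V)) U|
        ∂Measure.pi (fun _ : Edge d L => haarProbability G) := by
  classical
  set μ := haarProbability G with hμ
  set F : GaugeConfig d L G → ℝ := fun U => Real.exp (-β * wilsonAction ρ U) with hF
  set sH : Finset (Edge d L) := Finset.univ \
      {(p.1, p.2.1.1), (p.1.shift p.2.1.1, p.2.1.2), (p.1.shift p.2.1.2, p.2.1.1), (p.1, p.2.1.2)} with hsH
  set I : ℝ := ∫ U, |coordAvg μ s F U - q U * coordAvg μ (insert e s) F U|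
    ∂Measure.pi (fun _ : Edge d L => μ) with hI
  set X : ℝ := ∫ U, (ρ (plaquetteHolonomy U p.1 p.2.1.1 p.2.1.2)).trace.re * F U
    ∂Measure.pi (fun _ : Edge d L => μ) with hX
  obtain ⟨hFm, B, hFlo, hFhi⟩ := wilsonWeight_props (d := d) (L := L) ρ hρ β
  have hFabs : ∀ U : GaugeConfig d L G, |F U| ≤ Real.exp (|β| * B) := fun U => by
    rw [abs_of_pos (Real.exp_pos _)]; exact hFhi U
  haveI : Fact (1 < L) := ⟨hL⟩
  have hloop : e.1 ≠ e.1.shift e.2 := fun h => (site_shift_ne hL e.1 e.2) h.symm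
  have hqabs : ∀ U, |q U| ≤ Cq := fun U => by rw [abs_of_nonneg (hq0 U)]; exact hqb U
  -- blind at one endpoint: no better than Haar
  have hV := integral_abs_sub_le_of_vertexBlind s (insert e s) (isGaugeInvariant_wilsonWeightFun ρ β)
    hFm ⟨_, hFabs⟩ hy hloop hqm ⟨Cq, hqabs⟩ hqB hq1
  -- less context, closer to flat
  have heH : e ∉ sH := by
    rw [hsH, Finset.mem_sdiff, not_and, not_not]
    exact fun _ => he
  have hmono := integral_abs_condGap_mono μ hs heH hFm hFabs
  -- the engine, for this link
  have hH := wilson_plaquetteMarginal_tv_lower_bound_of_mem (d := d) (L := L) ρ hρ hL hω hne β p he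
  have hXle : X ≤ (N : ℝ) * I := hH.trans (mul_le_mul_of_nonneg_left (hmono.trans hV) (Nat.cast_nonneg N))
  have hI0 : 0 ≤ I := integral_nonneg fun U => abs_nonneg _
  rcases Nat.eq_zero_or_pos N with hN0 | hNpos
  · subst hN0
    simpa using hI0
  · have hNr : (0 : ℝ) < N := by exact_mod_cast hNpos
    calc (N : ℝ)⁻¹ * X ≤ (N : ℝ)⁻¹ * ((N : ℝ) * I) := mul_le_mul_of_nonneg_left hXle (inv_pos.2 hNr).le
      _ = I := by field_simp

end Summit.Ventures.LatticeQCDFlow.Theory2.Autoregressive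

end
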